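import Literature.AlgebraicGeometry.AbelianSchemes.FibreHomPointsOfFibrePoints
import Literature.AlgebraicGeometry.AbelianSchemes.AbelianSchemeFibreHom
import HarnessLib

/-!
# The group isomorphism `A_s(Ω) = Hom_S(Spec Ω, A) ≅ (A ×_S Spec Ω)(Ω)` between the two currencies for fibre points

Layer `Literature/AlgebraicGeometry/AbelianSchemes`, namespace `Literature.AlgebraicGeometry.AbelianSchemes.AbelianSchemeOver`.
Cell `hodgecm-mathlib` (D-0151), F-DAG price sheet §5b second-wave hand (h9) «local constancy of the type», FILE 2α
(author B-p02 (g12)); count-neutral capital, PROOF lane, theorems only.  HC_CM is proved only modulo the 7 printed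
citations until rung 0 closes; this file asserts nothing about HC.

★ `FibreHomPointsOfFibrePoints` establishes the correspondence between the tree's two currencies for the geometric fibre
points of an abelian scheme `A/S` at `s : Spec Ω → S` — `A.FibrePoints s = Hom_S(Spec Ω, A)` (Mathlib's `Hom`-group of
the group object `A.X` of `Over S`) and `(A.fibre s).toAbelianVariety.Points Ω` (the `Ω`-points of the fibre abelian
variety `A ×_S Spec Ω`) — as the RELATION `fibrePointToLeft s P = x.left`, bijective and compatible with units,
sections and homomorphisms.  THIS FILE packages it as a MULTIPLICATIVE EQUIVALENCE (existence form, no `def`): the map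
`u ↦ δ ≫ (Over.pullback s).map u` (with `δ : Spec Ω → Spec Ω ×_S Spec Ω` the diagonal point) is a group homomorphism
because the base-change functor `Over.pullback s` is (cartesian) monoidal (Mathlib `Functor.map_mul`) and precomposition
is multiplicative (Mathlib `MonObj.comp_mul`) — transport of structure along an equivalence already in Mathlib
([GortzWedhorn2020] (4.7.1) `Hom_S(T, X) = Hom_{S'}(T, X ×_S S')`).

* `exists_mulEquiv_fibrePoints_points` — `∃ e : A.FibrePoints s ≃* (A.fibre s).toAbelianVariety.Points Ω` with
  `fibrePointToLeft s (e u) = u.left` for all `u`;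
* `exists_mulEquiv_fibrePoints_points_map_eq_one_iff` — … and, for an `S`-homomorphism `f : A → B`,
  `f_s (e u) = 1 ↔ u ≫ f = 1` (★ `map_fibreHom_eq_one_iff_comp_eq_one`);
* `Polarization.exists_mulEquiv_fibrePoints_points_mem_kerPointsAt_iff` — for a polarisation `λ`:
  `e u ∈ kerPointsAt s ↔ u ≫ λ = 1` (★ `setOf_algPointsMap_fibreHom_eq_one_eq_kerPointsAt`);
* `Polarization.natCard_ker_torsion_fibrePoints_eq_natCard_kerPointsAt_torsion` — hence for every `m`
  `#{u ∈ Hom_S(Spec Ω, A) | u ≫ λ = 1, u^m = 1} = #{P ∈ A_s(Ω) | P ∈ K(λ̄), P^m = 1}` (a group isomorphism preserves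
  `m`-torsion) — the junction of ★ `HomKernelTorsionCount` (FibrePoints currency) with ★ `Polarization.HasType`
  (`kerPointsAt` currency).

## References
* [GortzWedhorn2020] U. Görtz, T. Wedhorn, *Algebraic Geometry I*, 2nd ed. (2020), Section (4.7), (4.7.1) (p. 108).
* [MumfordFogartyKirwan1994] D. Mumford, J. Fogarty, F. Kirwan, *Geometric Invariant Theory*, 3rd ed. (1994), Ch. 6 §2
  Definition 6.3 (p. 120); App. 7A (pp. 234–235).
-/

noncomputable section

universe u

open CategoryTheory CategoryTheory.Limits AlgebraicGeometry MonoidalCategory CartesianMonoidalCategory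

open scoped MonObj Obj

namespace Literature.AlgebraicGeometry.AbelianSchemes

namespace AbelianSchemeOver

open Literature.AlgebraicGeometry.Motives

variable {S : Scheme.{u}} (A : AbelianSchemeOver S) {B : AbelianSchemeOver S} {Ω : Type u} [Field Ω]
  (s : Spec (.of Ω) ⟶ S)

/-- **`Hom_S(Spec Ω, A) ≅ (A ×_S Spec Ω)(Ω)` as GROUPS.**  There is a multiplicative equivalence
`e : A.FibrePoints s ≃* (A.fibre s).toAbelianVariety.Points Ω` sending `u : Spec Ω →_S A` to its partner: the `Ω`-point
of the fibre whose underlying point of `A` is `u` (`fibrePointToLeft s (e u) = u.left`).  It is `u ↦ δ ≫ (u ×_S Spec Ω)`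
with `δ` the diagonal point of `Spec Ω ×_S Spec Ω`; multiplicative because base change is a monoidal functor (Mathlib
`Functor.map_mul`, `MonObj.comp_mul`), bijective by ★ `FibreHomPointsOfFibrePoints`.
[cite: GortzWedhorn2020, Section (4.7), (4.7.1) (p. 108)] -/
theorem exists_mulEquiv_fibrePoints_points :
    ∃ e : A.FibrePoints s ≃* (A.fibre s).toAbelianVariety.Points Ω, ∀ u, A.fibrePointToLeft s (e u) = u.left := by
  have hid : Spec.map (CommRingCat.ofHom (algebraMap Ω Ω)) = 𝟙 (Spec (.of Ω)) := by
    rw [Algebra.algebraMap_self, CommRingCat.ofHom_id, Spec.map_id]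
  -- the diagonal point `δ : Spec Ω → Spec Ω ×_S Spec Ω` as an `Ω`-point of `(Over.pullback s).obj (Over.mk s)`
  obtain ⟨δ, hδ⟩ : ∃ δ : specOver Ω Ω ⟶ (Over.pullback s).obj (Over.mk s),
      δ.left = pullback.lift (𝟙 _) (𝟙 _) rfl :=
    ⟨Over.homMk (pullback.lift (𝟙 _) (𝟙 _) rfl) (by
      change pullback.lift (𝟙 _) (𝟙 _) rfl ≫ pullback.snd s s = Spec.map (CommRingCat.ofHom (algebraMap Ω Ω))
      rw [pullback.lift_snd, hid]), rfl⟩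
  -- the homomorphism `u ↦ δ ≫ (Over.pullback s).map u`: base change is monoidal (`Functor.homMonoidHom`) and
  -- precomposition is multiplicative (`MonObj.comp_mul`)
  let Ψ : ((Over.pullback s).obj (Over.mk s) ⟶ (Over.pullback s).obj A.X) →*
      (specOver Ω Ω ⟶ (Over.pullback s).obj A.X) :=
    MonoidHom.mk' (fun g => δ ≫ g) (fun g h => MonObj.comp_mul δ g h)
  let Φ : A.FibrePoints s →* (A.fibre s).toAbelianVariety.Points Ω :=
    Ψ.comp (Functor.homMonoidHom (Over.pullback s))
  have hΦ : ∀ u, A.fibrePointToLeft s (Φ u) = u.left := fun u => by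
    have hmap : ((Over.pullback s).map u).left ≫ pullback.fst A.X.hom s = pullback.fst _ _ ≫ u.left :=
      pullback.lift_fst _ _ _
    change (δ.left ≫ ((Over.pullback s).map u).left) ≫ pullback.fst A.X.hom s = u.left
    rw [Category.assoc, hmap, hδ]
    exact (pullback.lift_fst_assoc _ _ _ _).trans (Category.id_comp _)
  refine ⟨MulEquiv.ofBijective Φ ⟨fun u v h => ?_, fun P => ?_⟩, hΦ⟩
  · exact A.fibrePoints_eq_of_fibrePointToLeft_eq s (hΦ u) ((congrArg (A.fibrePointToLeft s) h).trans (hΦ v))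
  · obtain ⟨x, hx⟩ := A.exists_fibrePoints_fibrePointToLeft_eq s P
    exact ⟨x, A.points_eq_of_fibrePointToLeft_eq s (hΦ x) hx⟩

/-- The group isomorphism is compatible with KERNELS of homomorphisms: for an `S`-homomorphism `f : A → B` and the
induced `f_s : A_s → B_s` (★ `fibreHom`), `f_s(e u) = 1 ↔ u ≫ f = 1` (★ `map_fibreHom_eq_one_iff_comp_eq_one`).
[cite: MumfordFogartyKirwan1994, Ch. 6 §2 Definition 6.3 (p. 120)] [cite: GortzWedhorn2020, Section (4.7), (4.7.1) (p. 108)] -/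
theorem exists_mulEquiv_fibrePoints_points_map_eq_one_iff (f : A.X ⟶ B.X) [IsMonHom f] :
    ∃ e : A.FibrePoints s ≃* (A.fibre s).toAbelianVariety.Points Ω,
      (∀ u, A.fibrePointToLeft s (e u) = u.left) ∧
        ∀ u, AlgPoints.map (fibreHom f s).hom.hom.hom (e u) = 1 ↔ u ≫ f = 1 := by
  obtain ⟨e, he⟩ := A.exists_mulEquiv_fibrePoints_points s
  exact ⟨e, he, fun u => map_fibreHom_eq_one_iff_comp_eq_one s f (he u)⟩

namespace Polarization

variable {A} {D : A.DualPair} (pol : A.Polarization D)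

/-- **The group isomorphism carries `{u | u ≫ λ = 1}` onto `K(λ̄) = kerPointsAt s`** (★
`setOf_algPointsMap_fibreHom_eq_one_eq_kerPointsAt`). [cite: MumfordFogartyKirwan1994, App. 7A (pp. 234–235)]
[cite: MumfordFogartyKirwan1994, Ch. 6 §2 Definition 6.3 (p. 120)] -/
theorem exists_mulEquiv_fibrePoints_points_mem_kerPointsAt_iff (s : Spec (.of Ω) ⟶ S) :
    ∃ e : A.FibrePoints s ≃* (A.fibre s).toAbelianVariety.Points Ω,
      (∀ u, A.fibrePointToLeft s (e u) = u.left) ∧ ∀ u, e u ∈ pol.kerPointsAt s ↔ u ≫ pol.lam = 1 := by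
  haveI := pol.isMonHom
  obtain ⟨e, he, hker⟩ := A.exists_mulEquiv_fibrePoints_points_map_eq_one_iff s pol.lam
  refine ⟨e, he, fun u => ?_⟩
  rw [← setOf_algPointsMap_fibreHom_eq_one_eq_kerPointsAt pol s]
  exact hker u

/-- **The `m`-torsion counts of the kernel agree in the two currencies**: for every `m`,
`#{u ∈ Hom_S(Spec Ω, A) | u ≫ λ = 1, u^m = 1} = #{P ∈ (A ×_S Spec Ω)(Ω) | P ∈ K(λ̄), P^m = 1}` (a group isomorphism
preserves `m`-th powers). [cite: MumfordFogartyKirwan1994, App. 7A (pp. 234–235)] -/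
theorem natCard_ker_torsion_fibrePoints_eq_natCard_kerPointsAt_torsion (s : Spec (.of Ω) ⟶ S) (m : ℕ) :
    Nat.card {u : A.FibrePoints s // u ≫ pol.lam = 1 ∧ u ^ m = 1} =
      Nat.card {P : (A.fibre s).toAbelianVariety.Points Ω // P ∈ pol.kerPointsAt s ∧ P ^ m = 1} := by
  obtain ⟨e, -, hker⟩ := pol.exists_mulEquiv_fibrePoints_points_mem_kerPointsAt_iff s
  refine Nat.card_congr (e.toEquiv.subtypeEquiv fun u => ?_)
  change _ ↔ e u ∈ pol.kerPointsAt s ∧ (e u) ^ m = 1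
  rw [hker u, ← map_pow, MulEquiv.map_eq_one_iff]

end Polarization

end AbelianSchemeOver

end Literature.AlgebraicGeometry.AbelianSchemes

end
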